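import Summits.BirchSwinnertonDyer.BirchSwinnertonDyer.Theorems.SignedLowerHalvesSprungLowerDivisibilityAtThreeSpanQuotientCert
import HarnessLib

/-!
# Crux `SprungLowerDivisibilityAtThree` (K1, item stmt-BirchSwinnertonDyer-19875), line `chromatic-common-zeros`:
# the QUOTIENT-DIGIT certificate for the NON-MEMBERSHIP datum `G ∉ (F)` (x8 DOSSIER item 249) — feeding the one-sided
# ι-rigidity doors (R10′)/(R11′) and the ι-self-rigidity doors (R12)/(R13)

Cell `bsd-ssimc` (host), width seat `cruxlead-stmt-BirchSwinnertonDyer-19875-w3` (gen 4) under the 19875 lead; `--supports`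
19875 `--as helper`; theorems only (pure `Λ = ℤ_p⟦T⟧` algebra, general `p`); closes NO item. K1, BSD and
leaf X8 are NOT proved by anything here.

The doors (R10′)/(R11′) (`…IotaRigidityMinimal`, p636556) take the datum `L^{other} ∉ (L^∘)` and (R12)/(R13)
(`…IotaRigiditySelf`, p637195) take `L^∘(T^ι) ∉ (L^∘)`. w2 g4's `span_ne_of_quotient_step_not_dvd` /
`span_ne_of_quotient_digit_cert` (p634635) certify the SPAN datum `(F) ≠ (G)`; the proofs only use `F = u·G`, so the
same recursion certifies NON-MEMBERSHIP `G ∉ (F)` (`G = h·F` impossible), dividing by `F₀`: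

* **`not_mem_span_of_quotient_step_not_dvd`** (exact form): `F₀ ≠ 0`, `F₀·w_q = G_q − Σ_{s<q} w_s F_{q−s}` (`q < i`),
  `F₀ ∤ G_i − Σ_{s<i} w_s F_{i−s}` ⟹ `G ∉ (F)`.
* **`not_mem_span_of_quotient_digit_cert`** (digit form): `p^g ∥ F₀`, steps solved modulo `p^N`, `(i+1)g ≤ N`,
  `p^g ∤ G_i − Σ_{s<i} w_s F_{i−s}` ⟹ `G ∉ (F)` — valid for every pair congruent to the data modulo `p^N` on the
  coefficients `≤ i`.
* `coeff_subst_invOnePlusSubOne_eq_sum` — `[T^e] F(T^ι) = Σ_{d ≤ e} F_d·[T^e](T^ι)^d` (finite, integer combination), so the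
  digits of `F(T^ι)` come from those of `F` (for (R12)/(R13)).
* Consumers compose: `not_mem_span_of_exists_quotient_digit_cert` discharges the datum of (R10′)/(R11′) (with `F = L^∘`,
  `G = L^{other}`) and of (R12)/(R13) (with `G = L^∘(T^ι)`, its digits via `pow_dvd_coeff_subst_sub_of_forall`).

References: [Washington1997] §7.1; tree: `…SpanQuotientCert` (p634635: `coeff_mul_eq_coeff_mul_constantCoeff_add`, the span forms),
`…IotaRigidityMinimal`, `…IotaRigiditySelf`.
-/

set_option autoImplicit false
set_option linter.dupNamespace false

noncomputable section

open scoped Classical NumberField MatrixGroups ModularForm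

open NumberField IsDedekindDomain CongruenceSubgroup WeierstrassCurve Field
  Literature.NumberTheory.EllipticCurves Literature.NumberTheory.EllipticCurves.ModularForms
  Literature.NumberTheory.EllipticCurves.ZpExtension Literature.NumberTheory.EllipticCurves.Sprung2017
  Literature.NumberTheory.EllipticCurves.Sprung2012 Literature.NumberTheory.EllipticCurves.Rank1Residual
  Literature.NumberTheory.EllipticCurves.IwasawaAlgebra Literature.Barriers.BirchSwinnertonDyer
  Summit.BirchSwinnertonDyer.BirchSwinnertonDyer.Theorems
  Summit.BirchSwinnertonDyer.BirchSwinnertonDyer.Theorems.ChromaticCommonZeros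
  Summit.BirchSwinnertonDyer.Rank1Residual.Supersingular
  Summit.BirchSwinnertonDyer.Rank1Residual.X1.MuLambda

namespace Summit.BirchSwinnertonDyer.BirchSwinnertonDyer.Theorems.ChromaticIota

/-! ### §1 Quotient certificates for `G ∉ (F)` -/

section Certificate

variable {p : ℕ} [Fact p.Prime]

/-- **Quotient-step certificate for NON-MEMBERSHIP (exact form).** If `w_0, …, w_{i−1}` solve the first `i` steps of the
division `G/F` exactly (`F₀·w_q = G_q − Σ_{s<q} w_s F_{q−s}`, `F₀ ≠ 0`) and `F₀ ∤ G_i − Σ_{s<i} w_s F_{i−s}`, then `G ∉ (F)`: were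
`G = h·F`, induction and cancellation of `F₀` give `h_q = w_q` (`q < i`), and then `F₀·h_i = G_i − Σ_{s<i} w_s F_{i−s}`.
[cite: Washington1997, §7.1] -/
theorem not_mem_span_of_quotient_step_not_dvd {F G : IwasawaAlgebra p} {i : ℕ} (w : ℕ → ℤ_[p])
    (hF0 : PowerSeries.constantCoeff F ≠ 0)
    (hw : ∀ q < i, PowerSeries.constantCoeff F * w q =
      PowerSeries.coeff q G - ∑ s ∈ Finset.range q, w s * PowerSeries.coeff (q - s) F)
    (hcert : ¬ PowerSeries.constantCoeff F ∣
      PowerSeries.coeff i G - ∑ s ∈ Finset.range i, w s * PowerSeries.coeff (i - s) F) :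
    G ∉ Ideal.span {F} := by
  intro hmem
  obtain ⟨h, hh⟩ := Ideal.mem_span_singleton'.mp hmem
  have hG : G = h * F := hh.symm
  -- `h_q = w_q` for `q < i`, by strong induction
  have hind : ∀ q < i, PowerSeries.coeff q h = w q := by
    intro q
    induction q using Nat.strong_induction_on with
    | _ q ih =>
      intro hq
      have hrec := coeff_mul_eq_coeff_mul_constantCoeff_add h F q
      rw [← hG] at hrec
      have hsum : ∑ s ∈ Finset.range q, PowerSeries.coeff s h * PowerSeries.coeff (q - s) F =
          ∑ s ∈ Finset.range q, w s * PowerSeries.coeff (q - s) F :=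
        Finset.sum_congr rfl fun s hs => by
          have hs' := Finset.mem_range.mp hs
          rw [ih s hs' (lt_trans hs' hq)]
      have h1 : PowerSeries.constantCoeff F * PowerSeries.coeff q h = PowerSeries.constantCoeff F * w q := by
        rw [hw q hq, hrec, hsum]; ring
      exact mul_left_cancel₀ hF0 h1
  apply hcert
  have hrec := coeff_mul_eq_coeff_mul_constantCoeff_add h F i
  rw [← hG] at hrec
  have hsum : ∑ s ∈ Finset.range i, PowerSeries.coeff s h * PowerSeries.coeff (i - s) F =
      ∑ s ∈ Finset.range i, w s * PowerSeries.coeff (i - s) F :=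
    Finset.sum_congr rfl fun s hs => by rw [hind s (Finset.mem_range.mp hs)]
  exact ⟨PowerSeries.coeff i h, by rw [hrec, hsum]; ring⟩

/-- **Quotient-DIGIT certificate for NON-MEMBERSHIP `G ∉ (F)`.** Let `g = v_p(F₀)` exactly (`p^g ∣ F₀`, `p^{g+1} ∤ F₀`),
`N ≥ (i+1)·g`, and let `w_0, …, w_{i−1} ∈ ℤ_p` solve the first `i` division steps of `G/F` modulo `p^N`:
`p^N ∣ F₀·w_q − (G_q − Σ_{s<q} w_s F_{q−s})` (`q < i`). If `p^g ∤ G_i − Σ_{s<i} w_s F_{i−s}`, then `G ∉ (F)`. All hypotheses hold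
for EVERY `(F, G)` congruent to given approximants modulo `p^N` on the coefficients `≤ i` — a per-pair DATA certificate.
[cite: Washington1997, §7.1] -/
theorem not_mem_span_of_quotient_digit_cert {F G : IwasawaAlgebra p} {g i N : ℕ} (w : ℕ → ℤ_[p])
    (hg : (p : ℤ_[p]) ^ g ∣ PowerSeries.constantCoeff F) (hg' : ¬ (p : ℤ_[p]) ^ (g + 1) ∣ PowerSeries.constantCoeff F)
    (hN : (i + 1) * g ≤ N)
    (hsteps : ∀ q < i, (p : ℤ_[p]) ^ N ∣ PowerSeries.constantCoeff F * w q -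
      (PowerSeries.coeff q G - ∑ s ∈ Finset.range q, w s * PowerSeries.coeff (q - s) F))
    (hcert : ¬ (p : ℤ_[p]) ^ g ∣
      PowerSeries.coeff i G - ∑ s ∈ Finset.range i, w s * PowerSeries.coeff (i - s) F) :
    G ∉ Ideal.span {F} := by
  intro hmem
  obtain ⟨h, hh⟩ := Ideal.mem_span_singleton'.mp hmem
  have hG : G = h * F := hh.symm
  have hP : Prime (p : ℤ_[p]) := PadicInt.prime_p
  -- `F₀ = p^g · c` with `p ∤ c`
  obtain ⟨c, hc⟩ := hg
  have hcp : ¬ (p : ℤ_[p]) ∣ c := fun h' => hg' (by rw [hc, pow_succ]; exact mul_dvd_mul_left _ h')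
  -- the recursion `F₀ h_q = G_q − Σ_{s<q} h_s F_{q−s}`
  have hrec : ∀ q, PowerSeries.coeff q G = PowerSeries.coeff q h * PowerSeries.constantCoeff F +
      ∑ s ∈ Finset.range q, PowerSeries.coeff s h * PowerSeries.coeff (q - s) F := fun q => by
    rw [hG]; exact coeff_mul_eq_coeff_mul_constantCoeff_add _ F q
  -- `p^{N−(q+1)g} ∣ w_q − h_q` for `q < i`, by strong induction
  have hind : ∀ q < i, (p : ℤ_[p]) ^ (N - (q + 1) * g) ∣ w q - PowerSeries.coeff q h := by
    intro q
    induction q using Nat.strong_induction_on with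
    | _ q ih =>
      intro hq
      have hid : PowerSeries.constantCoeff F * (w q - PowerSeries.coeff q h) =
          (PowerSeries.constantCoeff F * w q -
            (PowerSeries.coeff q G - ∑ s ∈ Finset.range q, w s * PowerSeries.coeff (q - s) F)) +
          ∑ s ∈ Finset.range q, (PowerSeries.coeff s h - w s) * PowerSeries.coeff (q - s) F := by
        rw [hrec q]
        simp only [sub_mul, Finset.sum_sub_distrib]
        ring
      have hdvd : (p : ℤ_[p]) ^ (N - q * g) ∣ PowerSeries.constantCoeff F * (w q - PowerSeries.coeff q h) := by
        rw [hid]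
        refine dvd_add (dvd_trans (pow_dvd_pow _ (Nat.sub_le N _)) (hsteps q hq)) (Finset.dvd_sum fun s hs => ?_)
        have hs' := Finset.mem_range.mp hs
        have h1 := ih s hs' (lt_trans hs' hq)
        have h2 : (p : ℤ_[p]) ^ (N - q * g) ∣ (p : ℤ_[p]) ^ (N - (s + 1) * g) :=
          pow_dvd_pow _ (Nat.sub_le_sub_left (Nat.mul_le_mul_right g (by omega)) N)
        exact dvd_mul_of_dvd_left (dvd_trans h2 (by rw [← neg_sub]; exact (dvd_neg.mpr h1))) _
      have hsplit : N - q * g = g + (N - (q + 1) * g) := by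
        have hqg : (q + 1) * g ≤ N := le_trans (Nat.mul_le_mul_right g (by omega)) hN
        rw [Nat.succ_mul] at hqg ⊢
        generalize q * g = x at hqg ⊢
        omega
      rw [hsplit, pow_add, hc, mul_assoc] at hdvd
      have h3 : (p : ℤ_[p]) ^ (N - (q + 1) * g) ∣ c * (w q - PowerSeries.coeff q h) :=
        (mul_dvd_mul_iff_left (pow_ne_zero g hP.ne_zero)).mp hdvd
      exact hP.pow_dvd_of_dvd_mul_left _ hcp h3
  apply hcert
  have hXi : PowerSeries.coeff i G - ∑ s ∈ Finset.range i, w s * PowerSeries.coeff (i - s) F =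
      PowerSeries.coeff i h * PowerSeries.constantCoeff F +
        ∑ s ∈ Finset.range i, (PowerSeries.coeff s h - w s) * PowerSeries.coeff (i - s) F := by
    rw [hrec i]
    simp only [sub_mul, Finset.sum_sub_distrib]
    ring
  rw [hXi]
  refine dvd_add (dvd_mul_of_dvd_right ⟨c, hc⟩ _) (Finset.dvd_sum fun s hs => ?_)
  have hs' := Finset.mem_range.mp hs
  have h1 := hind s hs'
  have hsg : g + (s + 1) * g ≤ N := by
    refine le_trans ?_ hN
    have e : g + (s + 1) * g = (s + 2) * g := by ring
    rw [e]
    exact Nat.mul_le_mul_right g (by omega)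
  have h2 : (p : ℤ_[p]) ^ g ∣ (p : ℤ_[p]) ^ (N - (s + 1) * g) := pow_dvd_pow _ (Nat.le_sub_of_add_le hsg)
  exact dvd_mul_of_dvd_left (dvd_trans h2 (by rw [← neg_sub]; exact (dvd_neg.mpr h1))) _

/-- The packaged certificate: an existential over `(g, i, N, w)`. [cite: Washington1997, §7.1] -/
theorem not_mem_span_of_exists_quotient_digit_cert {F G : IwasawaAlgebra p}
    (hcert : ∃ (g i N : ℕ) (w : ℕ → ℤ_[p]),
      (p : ℤ_[p]) ^ g ∣ PowerSeries.constantCoeff F ∧ ¬ (p : ℤ_[p]) ^ (g + 1) ∣ PowerSeries.constantCoeff F ∧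
      (i + 1) * g ≤ N ∧
      (∀ q < i, (p : ℤ_[p]) ^ N ∣ PowerSeries.constantCoeff F * w q -
        (PowerSeries.coeff q G - ∑ s ∈ Finset.range q, w s * PowerSeries.coeff (q - s) F)) ∧
      ¬ (p : ℤ_[p]) ^ g ∣ PowerSeries.coeff i G - ∑ s ∈ Finset.range i, w s * PowerSeries.coeff (i - s) F) :
    G ∉ Ideal.span {F} := by
  obtain ⟨g, i, N, w, hg, hg', hN, hsteps, hc⟩ := hcert
  exact not_mem_span_of_quotient_digit_cert w hg hg' hN hsteps hc

/-- **The digits of `F(T^ι)` from those of `F`**: `[T^e] F(T^ι) = Σ_{d ≤ e} F_d · [T^e] (T^ι)^d` (a finite INTEGER combination: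
`[T^e](T^ι)^d = (−1)^e·C(e−1, d−1)` for `1 ≤ d ≤ e`, `0` for `d > e`, `[e = 0]` for `d = 0`), so congruences modulo `p^N` on the
coefficients `≤ e` of `F` give the same for `F(T^ι)`. [cite: GreenbergLNM1716, §1] -/
theorem coeff_subst_invOnePlusSubOne_eq_sum (F : IwasawaAlgebra p) (e : ℕ) :
    PowerSeries.coeff e (PowerSeries.subst (invOnePlusSubOne : IwasawaAlgebra p) F) =
      ∑ d ∈ Finset.range (e + 1), PowerSeries.coeff d F *
        PowerSeries.coeff e ((invOnePlusSubOne : IwasawaAlgebra p) ^ d) := by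
  have h0 : PowerSeries.constantCoeff (invOnePlusSubOne : IwasawaAlgebra p) = 0 := constantCoeff_invOnePlusSubOne
  rw [PowerSeries.coeff_subst' (PowerSeries.HasSubst.of_constantCoeff_zero' h0),
    finsum_eq_sum_of_support_subset _ (s := Finset.range (e + 1)) ?_]
  · simp only [smul_eq_mul]
  · intro d hd
    simp only [Function.mem_support, ne_eq, Finset.coe_range, Set.mem_Iio] at hd ⊢
    by_contra hlt
    apply hd
    rw [PowerSeries.coeff_of_lt_order e (lt_of_lt_of_le (by exact_mod_cast (by omega : e < d))
      (natCast_le_order_pow h0 d)), smul_zero]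

/-- The congruence transfer: if `p^N ∣ F_d − a_d` for `d ≤ e` then `p^N ∣ [T^e]F(T^ι) − Σ_{d ≤ e} a_d·[T^e](T^ι)^d`.
[cite: GreenbergLNM1716, §1] -/
theorem pow_dvd_coeff_subst_sub_of_forall {F : IwasawaAlgebra p} {N e : ℕ} (a : ℕ → ℤ_[p])
    (ha : ∀ d ≤ e, (p : ℤ_[p]) ^ N ∣ PowerSeries.coeff d F - a d) :
    (p : ℤ_[p]) ^ N ∣ PowerSeries.coeff e (PowerSeries.subst (invOnePlusSubOne : IwasawaAlgebra p) F) -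
      ∑ d ∈ Finset.range (e + 1), a d * PowerSeries.coeff e ((invOnePlusSubOne : IwasawaAlgebra p) ^ d) := by
  rw [coeff_subst_invOnePlusSubOne_eq_sum, ← Finset.sum_sub_distrib]
  refine Finset.dvd_sum fun d hd => ?_
  rw [← sub_mul]
  exact dvd_mul_of_dvd_left (ha d (by have := Finset.mem_range.mp hd; omega)) _

end Certificate

end Summit.BirchSwinnertonDyer.BirchSwinnertonDyer.Theorems.ChromaticIota

end
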